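/-
Copyright (c) 2026 the pub-hodgecm-mathlib formalisation cell (harness21).  Prover seat hodgecm-mathlib-LH4-p13 (g10), req620 Track A «(D-RAM) FOUR-FRAME» squad
F0∕P3c∕LH4; the (β₂) road (R-36), β₂ WORD #34 «MIX-HI» (one socket family {`hU_mix`, `hD_mix`, ‹hL_mix_hi›}, lead LH4-p13): the CLASS FORM of the `−` literal —
per vertex and per cut set — in ‹OFF.v2›'s general-block letters; helper lane on h413 = stmt-HodgeConjecture-24833 (count-neutral).  2026-09-05.
-/
import Summits.HodgeConjecture.HodgeConjecture.Theorems.F0P3cDyRamCleanShellLabelLaw      -- ★ p864014 (this seat): §4 HEAD `exists_fixed_unit_latticeValueSet_eq_smul_xPlus_of_shell`, §5 `fence_endoGL_sub_one`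
import Summits.HodgeConjecture.HodgeConjecture.Theorems.F0P3cDyRamConeCellFaceAxis          -- ★ p861154 (LH4-p15): `valueSetMod_smul_xPlus_eq_plus_iff_exists_norm`, `valueSetMod_smul_xPlus_eq_iff_exists_norm`, `exists_norm_mul_inv_of_not_norm`
import Summits.HodgeConjecture.HodgeConjecture.Theorems.F0P3cDyRamBeta2ConesRowWindow      -- ★ (LH4-p12 lineage) ROW-R §3: `mapGL_eq_of_latticeInLevel` (a cut-set vertex is `Γ`-fixed)
import Literature.NumberTheory.LocalFields.ValuedCompleteIsAdicComplete                      -- ★ `isAdicComplete_valuedInteger_of_completeSpace`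
import HarnessLib

/-!
# Crux `H413`, line LH4 «(D-RAM) FOUR-FRAME» — the (β₂) road (R-36), β₂ WORD #34 «MIX-HI»: THE CLASS FORM OF THE `−` LITERAL — on the clean shell `VS ≠ V₊` IS `VS = V(c₀ • X₊)`

Cell `hodgecm-mathlib` (D-0151), FLOOR 0, crux item H413 = `stmt-HodgeConjecture-24833`, route of record `HCCMUnconditional`; squad F0∕P3c∕LH4; lane
`--supports stmt-HodgeConjecture-24833 --as helper` (count-neutral; pays NO tier-0 row).  THEOREMS ONLY (no `def`, no instance, no notation, no `sorry`, default heartbeats);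
★-only imports; states NO census law; the MIX-HI letters, (OFF), (ROW) and (β₂) stay HYPOTHESES of their holders.

WHAT (β₂ sub-dealer LH4-p04 (g10) WORD #34 (a): «TYPE NOW the mechanism-free reduction — band letter ⟸ two-character balance on the populated members; classes by the label
law»).  The three MIX-HI band letters of ★ `offRowU_of_bands` ∕ ★ `offRowD_of_bands` ∕ ★ `offRowLmix_of_hi` (`hU_mix`, `hD_mix`, ‹hL_mix_hi›) compare, on a cone cell, the
weighted count of members carrying a glued vertex with `VS_{m*} = valueSetMod σ ϖ m* X₊` (class `+`) against those with `¬ VS_{m*} = valueSetMod σ ϖ m* X₊` on the CLEAN shell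
`(d % 2, mcOfRecord d)`.  By the label law (★ p864014) the second literal is a CLASS too: THIS FILE rewrites it, in ‹OFF.v2›'s general-block letters, as
`VS_{m*} = valueSetMod σ ϖ m* (c₀ • X₊)` for ANY `σ`-fixed non-norm unit `c₀` — the two literals become the two values of ONE character, which is the shape an exchange
involution or a digit count can pay (the MIX-HI mechanism itself is OPEN: WORD #34 (b)).
* §1 `trace_det_fence_of_lam` — the fence of the general block is carried by `lam`: `_hlam1 : |lam − 1| ≤ |jEϖ^N|`, `_hlam2`, `_hρlam` give `|tr γ₂ − 2|, |det γ₂ − tr γ₂ + 1| ≤ |ϖ|^N`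
  (`jE tr γ₂ = lam + ρlam`, `jE det γ₂ = lam·ρlam`).
* §2 a cut-set vertex is `Γ`-FIXED — ★ `…Beta2ConesRowWindow.mapGL_eq_of_latticeInLevel` (reused; the letters' set-builders carry no `mapGL` conjunct, ★ p864014 wants one).
* §3 `exists_fixed_unit_valueSet_eq_smul_xPlus_of_shell_offBlock` — ★ p864014 §4 HEAD in the general-block letters with the `lam`-fence (`_hu1N`, `_hlam1`; no `_hg1`, no `mapGL`).
* §4 `shell_and_not_plus_iff_shell_and_minus` — per vertex: `Shell_c ∧ ¬ VS = V(X₊) ↔ Shell_c ∧ VS = V(c₀ • X₊)` (★ p861154's class dictionary at `m*`).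
* §5 `cutSet_not_plus_eq_minus` — the `−` cut set of the three letters, BYTE FOR BYTE, equals its class form (trailing literal rewritten under `∃ B, ∃ L₃`).

HONEST LABEL.  Count-neutral; nothing printed is asserted; no census law is stated; `hU_mix`, `hD_mix`, ‹hL_mix_hi› (the MIX-HI family), (ROW) and (β₂) stay OPEN with their
holders (β₂ `stub_law_cleanSgn₂` UNPROVED); `HC_CM` is proved only modulo the 7 printed citations (2 remaining named inputs: hLiu418 = `stmt-HodgeConjecture-24832`, h413 =
`stmt-HodgeConjecture-24833`) until rung 0 closes.

## References
* [Rogawski1990] J. D. Rogawski, *Automorphic Representations of Unitary Groups in Three Variables*, Ann. of Math. Stud. 123 (1990): §4.8 Case (a) p. 53, §4.9 Prop. 4.9.1 (b) p. 55.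
* [Serre1979] J.-P. Serre, *Local Fields*, GTM 67 (1979): Ch. V §3 Cor. 3 (norm classes of units: index two).
* [Jacobowitz1962] R. Jacobowitz, *Hermitian forms over local fields*, Amer. J. Math. 84 (1962): §4, §7 (unimodular lattices; `Stab`).
* [Kottwitz1986BaseChangeUnits] R. E. Kottwitz, *Base change for unit elements of Hecke algebras*, Compositio Math. 60 (1986): §1 pp. 240–241, §3.
-/

set_option autoImplicit false

noncomputable section

namespace Summit.HodgeConjecture.HodgeConjecture.Cruxes.H413.F0P3cDyRamMixHiClassForm

open scoped Valued WithZero Matrix MatrixGroups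
open WithZero
open Literature.NumberTheory.Automorphic Literature.NumberTheory.Automorphic.HermitianLattice Literature.NumberTheory.Automorphic.UnitaryLatticeTree
open Literature.NumberTheory.Automorphic.UnitaryThreeFourFrame (IsRamifiedQuadraticDatum)
open Literature.NumberTheory.Rogawski1990
open Literature.NumberTheory.LocalFields (isAdicComplete_valuedInteger_of_completeSpace)
open Literature.NumberTheory.LocalFields.WildQuadraticDatum (two_le_of_v_two_lt_one)
open Summit.HodgeConjecture.HodgeConjecture.Cruxes.H413.F0P3cDyRamFourFramePieces (valueSetMod xPlus mstarOfRecord)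
open Summit.HodgeConjecture.HodgeConjecture.Cruxes.H413.F0P3cDyRamFourFrameCensusDefs (LatticeInLevel LatticeNearTransvShell)
open Summit.HodgeConjecture.HodgeConjecture.Cruxes.H413.F0P3cDyRamStageOneBDefs (mcOfRecord)
open Summit.HodgeConjecture.HodgeConjecture.Cruxes.H413.F0P3cDyRamCleanShellLabelLaw
open Summit.HodgeConjecture.HodgeConjecture.Cruxes.H413.F0P3cDyRamBeta2ConesRowWindow (mapGL_eq_of_latticeInLevel)
open Summit.HodgeConjecture.HodgeConjecture.Cruxes.H413.F0P3cDyRamConeCellFaceAxis (valueSetMod_smul_xPlus_eq_plus_iff_exists_norm valueSetMod_smul_xPlus_eq_iff_exists_norm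
  exists_norm_mul_inv_of_not_norm)

variable {E M : Type} [Field E] [Valued E ℤᵐ⁰] [Field M] [Valued M ℤᵐ⁰]

/-! ## §1  The fence of the general block is carried by `lam` -/

omit [Valued E ℤᵐ⁰] [Valued M ℤᵐ⁰] in
/-- **`jE tr γ₂ = lam + ρlam`, `jE det γ₂ = lam·ρlam`** from the block letters `_hlam2` (`lam² = jE tr·lam − jE det`) and `_hρlam` (`ρlam = jE tr − lam`). [cite: Rogawski1990, §4.8 Case (a) p. 53] -/
theorem map_trace_det_eq_of_lam (jE : E →+* M) (ρ : M →+* M) {γ₂ : GL (Fin 2) E} {lam : M}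
    (hlam2 : lam * lam = jE (γ₂ : Matrix (Fin 2) (Fin 2) E).trace * lam - jE (γ₂ : Matrix (Fin 2) (Fin 2) E).det)
    (hρlam : ρ lam = jE (γ₂ : Matrix (Fin 2) (Fin 2) E).trace - lam) :
    jE (γ₂ : Matrix (Fin 2) (Fin 2) E).trace = lam + ρ lam ∧ jE (γ₂ : Matrix (Fin 2) (Fin 2) E).det = lam * ρ lam := by
  constructor
  · rw [hρlam]; ring
  · rw [hρlam]; linear_combination hlam2

/-- **THE FENCE FROM `lam`**: `|lam − 1| ≤ |jEϖ^n|`, `|ρz| = |z|`, `|jE c| = |c|` ⟹ `|tr γ₂ − 2| ≤ |ϖ|ⁿ` and `|det γ₂ − tr γ₂ + 1| ≤ |ϖ|ⁿ`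
(`jE(tr − 2) = (lam − 1) + ρ(lam − 1)`, `jE(det − tr + 1) = (lam − 1)·ρ(lam − 1)`). [cite: Rogawski1990, §4.8 Case (a) p. 53] -/
theorem trace_det_fence_of_lam {ϖ : E} (hϖ1 : Valued.v ϖ ≤ 1) (jE : E →+* M) (ρ : M →+* M) (hvρ : ∀ z, Valued.v (ρ z) = Valued.v z)
    (hjiso : ∀ a, Valued.v (jE a) = Valued.v a) {γ₂ : GL (Fin 2) E} {lam : M}
    (hlam2 : lam * lam = jE (γ₂ : Matrix (Fin 2) (Fin 2) E).trace * lam - jE (γ₂ : Matrix (Fin 2) (Fin 2) E).det)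
    (hρlam : ρ lam = jE (γ₂ : Matrix (Fin 2) (Fin 2) E).trace - lam) {n : ℕ} (hlam1 : Valued.v (lam - 1) ≤ Valued.v (jE ϖ ^ n)) :
    Valued.v ((γ₂ : Matrix (Fin 2) (Fin 2) E).trace - 2) ≤ Valued.v ϖ ^ n ∧
      Valued.v ((γ₂ : Matrix (Fin 2) (Fin 2) E).det - (γ₂ : Matrix (Fin 2) (Fin 2) E).trace + 1) ≤ Valued.v ϖ ^ n := by
  obtain ⟨htr, hdet⟩ := map_trace_det_eq_of_lam jE ρ hlam2 hρlam
  have hl : Valued.v (lam - 1) ≤ Valued.v ϖ ^ n := by rw [map_pow, hjiso] at hlam1; exact hlam1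
  have hρl : Valued.v (ρ (lam - 1)) ≤ Valued.v ϖ ^ n := by rw [hvρ]; exact hl
  have hn2 : Valued.v ϖ ^ n * Valued.v ϖ ^ n ≤ Valued.v ϖ ^ n := (mul_le_mul' (pow_le_one₀ zero_le hϖ1) le_rfl).trans_eq (one_mul _)
  constructor
  · rw [← hjiso, map_sub, htr, map_ofNat, show lam + ρ lam - 2 = (lam - 1) + ρ (lam - 1) by rw [map_sub, map_one]; ring]
    exact (Valuation.map_add _ _ _).trans (max_le hl hρl)
  · rw [← hjiso, map_add, map_sub, hdet, htr, map_one, show lam * ρ lam - (lam + ρ lam) + 1 = (lam - 1) * ρ (lam - 1) by rw [map_sub, map_one]; ring,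
      map_mul]
    exact (mul_le_mul' hl hρl).trans hn2

/-! ## §2  (A cut-set vertex is `Γ`-fixed: ★ `F0P3cDyRamBeta2ConesRowWindow.mapGL_eq_of_latticeInLevel` — `X·L ⊆ ϖ^ℓ L` + `Γ ∈ U(σ,H)` at a self-dual `L` ⟹ `Γ·L = L`; reused, not restated.) -/

/-! ## §3  The label law in the general block with the `lam`-fence -/

/-- **THE LABEL LAW, GENERAL BLOCK, `lam`-FENCE** (‹OFF.v2› letters `σ ϖ d tE _hD _h2 jE ρ lam _hvρ _hjiso γ₂ u _hlam2 _hρlam _hu1N _hlam1 H₂ hW _hH₂σ _hhWσ P₁ _hA _hΓ`, fence exponent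
`n := N d tE (Nat.card 𝓀[E])` with the holder's floor `mcOfRecord d ≤ n`; per vertex ONLY self-duality and the clean shell — `Γ`-fixedness by ★ `mapGL_eq_of_latticeInLevel`): for a `σ`-fixed unit `e′`,
`VS_{m*}(L₃) = valueSetMod σ ϖ (mstarOfRecord d) (e′ • xPlus σ ϖ d)` (★ p864014 §4 HEAD; fence by §1 + ★ `fence_endoGL_sub_one`).
[cite: Rogawski1990, §4.9 Prop. 4.9.1 (b) p. 55] [cite: Kottwitz1986BaseChangeUnits, §1 pp. 240–241] [cite: Jacobowitz1962, §4, §7] -/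
theorem exists_fixed_unit_valueSet_eq_smul_xPlus_of_shell_offBlock
    (σ : E →+* E) (ϖ : E) (d tE : ℕ) (_hD : IsRamifiedQuadraticDatum σ ϖ d tE) (_h2 : ¬ IsUnit (2 : 𝒪[E]))
    (jE : E →+* M) (ρ : M →+* M) (lam : M) (_hvρ : ∀ z, Valued.v (ρ z) = Valued.v z) (_hjiso : ∀ a, Valued.v (jE a) = Valued.v a)
    (γ₂ : GL (Fin 2) E) (u : GL (Fin 1) E)
    (_hlam2 : lam * lam = jE (γ₂ : Matrix (Fin 2) (Fin 2) E).trace * lam - jE (γ₂ : Matrix (Fin 2) (Fin 2) E).det)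
    (_hρlam : ρ lam = jE (γ₂ : Matrix (Fin 2) (Fin 2) E).trace - lam) {n : ℕ} (hn : mcOfRecord d ≤ n)
    (_hu1N : Valued.v (((u : Matrix (Fin 1) (Fin 1) E) 0 0) - 1) ≤ Valued.v (ϖ ^ n)) (_hlam1 : Valued.v (lam - 1) ≤ Valued.v (jE ϖ ^ n))
    (H₂ : Matrix (Fin 2) (Fin 2) E) (hW : E) (_hH₂σ : (H₂.map σ)ᵀ = H₂) (_hhWσ : σ hW = hW)
    (P₁ : GL (Fin 3) E) (_hA : formCongr σ P₁ ((StdForm.antidiagonal 3).over E) = (!![H₂ 0 0, 0, H₂ 0 1; 0, hW, 0; H₂ 1 0, 0, H₂ 1 1] : Matrix (Fin 3) (Fin 3) E))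
    (_hΓ : P₁ * endoGL (γ₂, u) * P₁⁻¹ ∈ unitaryGroupOfForm σ ((StdForm.antidiagonal 3).over E))
    {L₃ : Submodule 𝒪[E] (Fin 3 → E)} (hL₃ : IsSelfDualLattice σ ϖ (!![H₂ 0 0, 0, H₂ 0 1; 0, hW, 0; H₂ 1 0, 0, H₂ 1 1] : Matrix (Fin 3) (Fin 3) E) L₃)
    (hshell : LatticeNearTransvShell ϖ (d % 2) (mcOfRecord d) (((endoGL (γ₂, u) : GL (Fin 3) E) : Matrix (Fin 3) (Fin 3) E) - 1) L₃) :
    ∃ e' : E, σ e' = e' ∧ Valued.v e' = 1 ∧ {z : E | ∃ y ∈ L₃, Valued.v ((ϖ ^ (mstarOfRecord d))⁻¹ * (z - pairing σ (!![H₂ 0 0, 0, H₂ 0 1; 0, hW, 0; H₂ 1 0, 0, H₂ 1 1] : Matrix (Fin 3) (Fin 3) E) y (((((endoGL (γ₂, u) : GL (Fin 3) E) : Matrix (Fin 3) (Fin 3) E) - 1)) *ᵥ y))) ≤ 1} = valueSetMod σ ϖ (mstarOfRecord d) (e' • xPlus σ ϖ d) := by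
  obtain ⟨hσσ, hvσ, hϖ, hfix, hdd, -, ht⟩ := id _hD
  have hvϖ0 : Valued.v ϖ ≠ 0 := by rw [hϖ]; exact exp_ne_zero
  have hϖ0 : ϖ ≠ 0 := fun h0 => by rw [h0, map_zero] at hvϖ0; exact hvϖ0 rfl
  have hϖ1 : Valued.v ϖ ≤ 1 := by rw [hϖ, ← exp_zero, exp_le_exp]; norm_num
  have h2v : Valued.v (2 : E) < 1 := by exact_mod_cast Valuation.Integer.not_isUnit_iff_valuation_lt_one.mp _h2
  have hd2 : 2 ≤ d := two_le_of_v_two_lt_one hσσ hvσ hfix hϖ hdd ht h2v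
  have hHe : ∀ i j, σ (H₂ j i) = H₂ i j := fun i j => by
    have e := congrFun (congrFun _hH₂σ i) j
    rwa [Matrix.transpose_apply, Matrix.map_apply] at e
  have hH : ((!![H₂ 0 0, 0, H₂ 0 1; 0, hW, 0; H₂ 1 0, 0, H₂ 1 1] : Matrix (Fin 3) (Fin 3) E).map σ)ᵀ = (!![H₂ 0 0, 0, H₂ 0 1; 0, hW, 0; H₂ 1 0, 0, H₂ 1 1] : Matrix (Fin 3) (Fin 3) E) := by
    ext i j; fin_cases i <;> fin_cases j <;> simp [hHe, _hhWσ]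
  have hΓ : endoGL (γ₂, u) ∈ unitaryGroupOfForm σ (!![H₂ 0 0, 0, H₂ 0 1; 0, hW, 0; H₂ 1 0, 0, H₂ 1 1] : Matrix (Fin 3) (Fin 3) E) := by
    rw [← _hA]; exact (conj_mem_unitaryGroupOfForm_iff σ P₁ _ _).1 _hΓ
  have hfixL : mapGL (endoGL (γ₂, u)) L₃ = L₃ := mapGL_eq_of_latticeInLevel hvσ hϖ0 hϖ1 hΓ hL₃ hshell.1
  obtain ⟨htr2, hdet2⟩ := trace_det_fence_of_lam hϖ1 jE ρ _hvρ _hjiso _hlam2 _hρlam _hlam1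
  have hu1 : Valued.v (((u : Matrix (Fin 1) (Fin 1) E) 0 0) - 1) ≤ Valued.v ϖ ^ n := by rw [map_pow] at _hu1N; exact _hu1N
  obtain ⟨htrX, he₂X⟩ := fence_endoGL_sub_one hϖ1 γ₂ u htr2 hdet2 hu1 rfl
  exact exists_fixed_unit_latticeValueSet_eq_smul_xPlus_of_shell _hD hd2 _ hH hL₃ hΓ hfixL rfl hshell hn htrX he₂X

/-! ## §4  Per vertex: on the clean shell, `¬ (VS = V(X₊))` is `VS = V(c₀ • X₊)` -/

/-- **THE CLASS FORM OF THE `−` LITERAL, PER VERTEX.**  Same letters as §3 plus `[CompleteSpace E]` and a `σ`-fixed NON-norm unit `c₀`: for a self-dual `L₃`,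
`(Shell_c L₃ ∧ ¬ VS_{m*}(L₃) = valueSetMod σ ϖ m* X₊) ↔ (Shell_c L₃ ∧ VS_{m*}(L₃) = valueSetMod σ ϖ m* (c₀ • X₊))` — the law gives a class `e′`; `e′ ∉ N ⟺ ¬(= V₊)`
(★ `valueSetMod_smul_xPlus_eq_plus_iff_exists_norm`) and two fixed non-norms have a norm quotient (★ `exists_norm_mul_inv_of_not_norm`, ★ `valueSetMod_smul_xPlus_eq_iff_exists_norm`).
[cite: Serre1979, Ch. V §3 Cor. 3] [cite: Rogawski1990, §4.9 Prop. 4.9.1 (b) p. 55] -/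
theorem shell_and_not_plus_iff_shell_and_minus [CompleteSpace E] [Finite 𝓀[E]]
    (σ : E →+* E) (ϖ : E) (d tE : ℕ) (_hD : IsRamifiedQuadraticDatum σ ϖ d tE) (_h2 : ¬ IsUnit (2 : 𝒪[E]))
    (jE : E →+* M) (ρ : M →+* M) (lam : M) (_hvρ : ∀ z, Valued.v (ρ z) = Valued.v z) (_hjiso : ∀ a, Valued.v (jE a) = Valued.v a)
    (γ₂ : GL (Fin 2) E) (u : GL (Fin 1) E)
    (_hlam2 : lam * lam = jE (γ₂ : Matrix (Fin 2) (Fin 2) E).trace * lam - jE (γ₂ : Matrix (Fin 2) (Fin 2) E).det)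
    (_hρlam : ρ lam = jE (γ₂ : Matrix (Fin 2) (Fin 2) E).trace - lam) {n : ℕ} (hn : mcOfRecord d ≤ n)
    (_hu1N : Valued.v (((u : Matrix (Fin 1) (Fin 1) E) 0 0) - 1) ≤ Valued.v (ϖ ^ n)) (_hlam1 : Valued.v (lam - 1) ≤ Valued.v (jE ϖ ^ n))
    (H₂ : Matrix (Fin 2) (Fin 2) E) (hW : E) (_hH₂σ : (H₂.map σ)ᵀ = H₂) (_hhWσ : σ hW = hW)
    (P₁ : GL (Fin 3) E) (_hA : formCongr σ P₁ ((StdForm.antidiagonal 3).over E) = (!![H₂ 0 0, 0, H₂ 0 1; 0, hW, 0; H₂ 1 0, 0, H₂ 1 1] : Matrix (Fin 3) (Fin 3) E))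
    (_hΓ : P₁ * endoGL (γ₂, u) * P₁⁻¹ ∈ unitaryGroupOfForm σ ((StdForm.antidiagonal 3).over E))
    {c₀ : E} (hσc₀ : σ c₀ = c₀) (hc₀1 : Valued.v c₀ = 1) (hc₀N : ¬ ∃ z : E, z * σ z = c₀)
    {L₃ : Submodule 𝒪[E] (Fin 3 → E)} (hL₃ : IsSelfDualLattice σ ϖ (!![H₂ 0 0, 0, H₂ 0 1; 0, hW, 0; H₂ 1 0, 0, H₂ 1 1] : Matrix (Fin 3) (Fin 3) E) L₃) :
    (LatticeNearTransvShell ϖ (d % 2) (mcOfRecord d) (((endoGL (γ₂, u) : GL (Fin 3) E) : Matrix (Fin 3) (Fin 3) E) - 1) L₃ ∧ ¬ {z : E | ∃ y ∈ L₃, Valued.v ((ϖ ^ (mstarOfRecord d))⁻¹ * (z - pairing σ (!![H₂ 0 0, 0, H₂ 0 1; 0, hW, 0; H₂ 1 0, 0, H₂ 1 1] : Matrix (Fin 3) (Fin 3) E) y (((((endoGL (γ₂, u) : GL (Fin 3) E) : Matrix (Fin 3) (Fin 3) E) - 1)) *ᵥ y))) ≤ 1} = valueSetMod σ ϖ (mstarOfRecord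 d) (xPlus σ ϖ d)) ↔
      (LatticeNearTransvShell ϖ (d % 2) (mcOfRecord d) (((endoGL (γ₂, u) : GL (Fin 3) E) : Matrix (Fin 3) (Fin 3) E) - 1) L₃ ∧ {z : E | ∃ y ∈ L₃, Valued.v ((ϖ ^ (mstarOfRecord d))⁻¹ * (z - pairing σ (!![H₂ 0 0, 0, H₂ 0 1; 0, hW, 0; H₂ 1 0, 0, H₂ 1 1] : Matrix (Fin 3) (Fin 3) E) y (((((endoGL (γ₂, u) : GL (Fin 3) E) : Matrix (Fin 3) (Fin 3) E) - 1)) *ᵥ y))) ≤ 1} = valueSetMod σ ϖ (mstarOfRecord d) (c₀ • xPlus σ ϖ d)) := by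
  haveI := isAdicComplete_valuedInteger_of_completeSpace (K := E) _hD.2.2.1
  refine and_congr_right fun hshell => ?_
  obtain ⟨e', he'σ, he'1, hVS⟩ := exists_fixed_unit_valueSet_eq_smul_xPlus_of_shell_offBlock σ ϖ d tE _hD _h2 jE ρ lam _hvρ _hjiso γ₂ u _hlam2 _hρlam hn
    _hu1N _hlam1 H₂ hW _hH₂σ _hhWσ P₁ _hA _hΓ hL₃ hshell
  rw [hVS, valueSetMod_smul_xPlus_eq_plus_iff_exists_norm _hD he'σ he'1, valueSetMod_smul_xPlus_eq_iff_exists_norm _hD he'σ he'1 hσc₀ hc₀1]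
  constructor
  · exact fun hN => exists_norm_mul_inv_of_not_norm _hD he'σ hN hσc₀ hc₀N
  · rintro ⟨z, hz⟩ ⟨w, hw⟩
    -- `e′∕c₀` and `e′` norms ⇒ `c₀` a norm
    have he'0 : e' ≠ 0 := fun h0 => by rw [h0, map_zero] at he'1; exact zero_ne_one he'1
    apply hc₀N
    refine ⟨w / z, ?_⟩
    rw [map_div₀, div_mul_div_comm, hw, hz, ← div_div, div_self he'0, one_div, inv_inv]

/-! ## §5  The `−` cut set of the MIX-HI letters, BYTE FOR BYTE, in class form -/

/-- **THE CLASS FORM OF THE `−` CUT SET** (the set-builder of ★ `offRowU_of_bands` ∕ `offRowD_of_bands` ∕ `offRowLmix_of_hi`'s `−` literal, tube `b`, VERBATIM): under §4's letters,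
`{Λ | ∃ B, φB = Λ ∧ ∃ L₃, SD ∧ L₃ ∩ W = ι B ∧ tube_b ∧ (Shell_c ∧ ¬ VS = V(X₊))} = {Λ | … ∧ (Shell_c ∧ VS = V(c₀ • X₊))}`.
[cite: Serre1979, Ch. V §3 Cor. 3] [cite: Rogawski1990, §4.9 Prop. 4.9.1 (b) p. 55] [cite: Kottwitz1986BaseChangeUnits, §1 pp. 240–241] -/
theorem cutSet_not_plus_eq_minus [CompleteSpace E] [Finite 𝓀[E]]
    (σ : E →+* E) (ϖ : E) (d tE : ℕ) (_hD : IsRamifiedQuadraticDatum σ ϖ d tE) (_h2 : ¬ IsUnit (2 : 𝒪[E]))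
    (jE : E →+* M) (ρ : M →+* M) (lam : M) (_hvρ : ∀ z, Valued.v (ρ z) = Valued.v z) (_hjiso : ∀ a, Valued.v (jE a) = Valued.v a)
    (γ₂ : GL (Fin 2) E) (u : GL (Fin 1) E)
    (_hlam2 : lam * lam = jE (γ₂ : Matrix (Fin 2) (Fin 2) E).trace * lam - jE (γ₂ : Matrix (Fin 2) (Fin 2) E).det)
    (_hρlam : ρ lam = jE (γ₂ : Matrix (Fin 2) (Fin 2) E).trace - lam) {n : ℕ} (hn : mcOfRecord d ≤ n)
    (_hu1N : Valued.v (((u : Matrix (Fin 1) (Fin 1) E) 0 0) - 1) ≤ Valued.v (ϖ ^ n)) (_hlam1 : Valued.v (lam - 1) ≤ Valued.v (jE ϖ ^ n))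
    (H₂ : Matrix (Fin 2) (Fin 2) E) (hW : E) (_hH₂σ : (H₂.map σ)ᵀ = H₂) (_hhWσ : σ hW = hW)
    (P₁ : GL (Fin 3) E) (_hA : formCongr σ P₁ ((StdForm.antidiagonal 3).over E) = (!![H₂ 0 0, 0, H₂ 0 1; 0, hW, 0; H₂ 1 0, 0, H₂ 1 1] : Matrix (Fin 3) (Fin 3) E))
    (_hΓ : P₁ * endoGL (γ₂, u) * P₁⁻¹ ∈ unitaryGroupOfForm σ ((StdForm.antidiagonal 3).over E))
    (φ : (Fin 2 → E) →+ M) (b : ℕ)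
    {c₀ : E} (hσc₀ : σ c₀ = c₀) (hc₀1 : Valued.v c₀ = 1) (hc₀N : ¬ ∃ z : E, z * σ z = c₀) :
    {Λ | ∃ B : Submodule 𝒪[E] (Fin 2 → E), B.toAddSubgroup.map φ = Λ ∧
        ∃ L₃ : Submodule 𝒪[E] (Fin 3 → E), IsSelfDualLattice σ ϖ (!![H₂ 0 0, 0, H₂ 0 1; 0, hW, 0; H₂ 1 0, 0, H₂ 1 1] : Matrix (Fin 3) (Fin 3) E) L₃ ∧
          L₃ ⊓ LinearMap.ker ((LinearMap.proj (1 : Fin 3) : (Fin 3 → E) →ₗ[E] E).restrictScalars 𝒪[E]) =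
            B.map ((Matrix.toLin' (!![1, 0; 0, 0; 0, 1] : Matrix (Fin 3) (Fin 2) E)).restrictScalars 𝒪[E]) ∧
          (∀ c : E, (Pi.single 1 c : Fin 3 → E) ∈ L₃ ↔ Valued.v c ≤ Valued.v ϖ ^ b) ∧
          (LatticeNearTransvShell ϖ (d % 2) (mcOfRecord d) (((endoGL (γ₂, u) : GL (Fin 3) E) : Matrix (Fin 3) (Fin 3) E) - 1) L₃ ∧
            ¬ {z : E | ∃ y ∈ L₃, Valued.v ((ϖ ^ (mstarOfRecord d))⁻¹ * (z - pairing σ (!![H₂ 0 0, 0, H₂ 0 1; 0, hW, 0; H₂ 1 0, 0, H₂ 1 1] : Matrix (Fin 3) (Fin 3) E) y (((((endoGL (γ₂, u) : GL (Fin 3) E) : Matrix (Fin 3) (Fin 3) E) - 1)) *ᵥ y))) ≤ 1} =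
              valueSetMod σ ϖ (mstarOfRecord d) (xPlus σ ϖ d))} =
      {Λ | ∃ B : Submodule 𝒪[E] (Fin 2 → E), B.toAddSubgroup.map φ = Λ ∧
        ∃ L₃ : Submodule 𝒪[E] (Fin 3 → E), IsSelfDualLattice σ ϖ (!![H₂ 0 0, 0, H₂ 0 1; 0, hW, 0; H₂ 1 0, 0, H₂ 1 1] : Matrix (Fin 3) (Fin 3) E) L₃ ∧
          L₃ ⊓ LinearMap.ker ((LinearMap.proj (1 : Fin 3) : (Fin 3 → E) →ₗ[E] E).restrictScalars 𝒪[E]) =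
            B.map ((Matrix.toLin' (!![1, 0; 0, 0; 0, 1] : Matrix (Fin 3) (Fin 2) E)).restrictScalars 𝒪[E]) ∧
          (∀ c : E, (Pi.single 1 c : Fin 3 → E) ∈ L₃ ↔ Valued.v c ≤ Valued.v ϖ ^ b) ∧
          (LatticeNearTransvShell ϖ (d % 2) (mcOfRecord d) (((endoGL (γ₂, u) : GL (Fin 3) E) : Matrix (Fin 3) (Fin 3) E) - 1) L₃ ∧
            {z : E | ∃ y ∈ L₃, Valued.v ((ϖ ^ (mstarOfRecord d))⁻¹ * (z - pairing σ (!![H₂ 0 0, 0, H₂ 0 1; 0, hW, 0; H₂ 1 0, 0, H₂ 1 1] : Matrix (Fin 3) (Fin 3) E) y (((((endoGL (γ₂, u) : GL (Fin 3) E) : Matrix (Fin 3) (Fin 3) E) - 1)) *ᵥ y))) ≤ 1} =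
              valueSetMod σ ϖ (mstarOfRecord d) (c₀ • xPlus σ ϖ d))} := by
  ext Λ
  simp only [Set.mem_setOf_eq]
  refine exists_congr fun B => and_congr_right fun _ => exists_congr fun L₃ => ?_
  refine ⟨fun ⟨hSD, hK, hT, hlast⟩ => ⟨hSD, hK, hT, ?_⟩, fun ⟨hSD, hK, hT, hlast⟩ => ⟨hSD, hK, hT, ?_⟩⟩
  · exact (shell_and_not_plus_iff_shell_and_minus σ ϖ d tE _hD _h2 jE ρ lam _hvρ _hjiso γ₂ u _hlam2 _hρlam hn _hu1N _hlam1 H₂ hW _hH₂σ _hhWσ P₁ _hA _hΓ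
      hσc₀ hc₀1 hc₀N hSD).1 hlast
  · exact (shell_and_not_plus_iff_shell_and_minus σ ϖ d tE _hD _h2 jE ρ lam _hvρ _hjiso γ₂ u _hlam2 _hρlam hn _hu1N _hlam1 H₂ hW _hH₂σ _hhWσ P₁ _hA _hΓ
      hσc₀ hc₀1 hc₀N hSD).2 hlast

end Summit.HodgeConjecture.HodgeConjecture.Cruxes.H413.F0P3cDyRamMixHiClassForm

end
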